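import Mathlib.Algebra.Polynomial.PartialFractions
import Mathlib.FieldTheory.IsAlgClosed.Basic
import Mathlib.Algebra.BigOperators.Field
import HarnessLib

/-!
# Partial fractions of a rational function over an algebraically closed field, evaluated

For `P, Q ∈ K[X]`, `K` algebraically closed, `Q ≠ 0`: with `s` the set of roots of `Q`, `n_a` their
multiplicities and `lc` the leading coefficient (`Q = lc · Π_{a ∈ s} (X − a)^{n_a}`), Mathlib's
partial fraction decomposition with powers
(`Polynomial.eq_quo_mul_prod_pow_add_sum_rem_mul_prod_pow`, denominators `X − a`, remainders of
degree `< 1`, i.e. constants `c_{a,j}`) gives, at every point `x` with `Q(x) ≠ 0`, the EVALUATED form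
  `P(x)/Q(x) = (quo(x) + Σ_{a ∈ s} Σ_{j < n_a} c_{a,j}/(x − a)^{n_a − j}) / lc`
(`exists_partialFraction_eval`). This is the input of the Baker normal form of one-variable rational
integrands (dilation lifting problem, route `KontsevichZagierPeriods/LiftingCriteria`).

Everything is proved; no `def`, no named fact.

## References
* standard algebra (partial fractions). [`Baker1975` is NOT used here]
-/

noncomputable section

open Polynomial
open scoped BigOperators

namespace Literature.NumberTheory.Transcendental

namespace KZ.BakerSectorComplex

/-- **Evaluated partial fractions over an algebraically closed field.** See the module docstring:
`P(x)/Q(x) = (quo(x) + Σ_{a ∈ roots Q} Σ_{j < mult a} c_{a,j}/(x − a)^{mult a − j}) / lc(Q)` whenever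
`Q(x) ≠ 0`. [folklore] -/
theorem exists_partialFraction_eval {K : Type*} [Field K] [IsAlgClosed K] [DecidableEq K]
    (P Q : K[X]) (hQ : Q ≠ 0) :
    ∃ (quo : K[X]) (c : K → ℕ → K), ∀ x : K, Q.eval x ≠ 0 →
      P.eval x / Q.eval x =
        (quo.eval x + ∑ a ∈ Q.roots.toFinset, ∑ j ∈ Finset.range (Q.rootMultiplicity a),
          c a j / (x - a) ^ (Q.rootMultiplicity a - j)) / Q.leadingCoeff := by
  classical
  set s : Finset K := Q.roots.toFinset with hs
  set n : K → ℕ := fun a => Q.rootMultiplicity a with hn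
  -- `Q = lc · Π_{a ∈ s} (X − a)^{n a}`
  have hQprod : Q = C Q.leadingCoeff * ∏ a ∈ s, (X - C a) ^ n a := by
    rw [← prod_multiset_root_eq_finset_root,
      C_leadingCoeff_mul_prod_multiset_X_sub_C (IsAlgClosed.card_roots_eq_natDegree)]
  -- partial fractions with powers, denominators `X − a`
  have hmonic : ∀ a ∈ s, (X - C a : K[X]).Monic := fun a _ => monic_X_sub_C a
  have hcop : Set.Pairwise (s : Set K) fun a b => IsCoprime (X - C a : K[X]) (X - C b) :=
    fun a _ b _ hab => (pairwise_coprime_X_sub_C Function.injective_id) hab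
  obtain ⟨quo, r, hdeg, hP⟩ := eq_quo_mul_prod_pow_add_sum_rem_mul_prod_pow P hmonic hcop n
  -- the remainders are constants
  have hrC : ∀ a ∈ s, ∀ j : Fin (n a), r a j = C ((r a j).coeff 0) := by
    intro a ha j
    have h := hdeg a ha j
    rw [degree_X_sub_C] at h
    by_cases hr : r a j = 0
    · rw [hr]; simp
    · exact eq_C_of_natDegree_eq_zero (Nat.lt_one_iff.mp ((natDegree_lt_iff_degree_lt hr).mpr h))
  refine ⟨quo, fun a j => if h : j < n a then (r a ⟨j, h⟩).coeff 0 else 0, fun x hx => ?_⟩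
  -- evaluate
  have hlc : Q.leadingCoeff ≠ 0 := leadingCoeff_ne_zero.mpr hQ
  have hxa : ∀ a ∈ s, x - a ≠ 0 := by
    intro a ha h0
    have hxa' : x = a := sub_eq_zero.mp h0
    have hroot : IsRoot Q a := (mem_roots hQ).mp (Multiset.mem_toFinset.mp ha)
    exact hx (by rw [hxa']; exact hroot)
  set PX : K := ∏ a ∈ s, (x - a) ^ n a with hPX
  have hPX0 : PX ≠ 0 := Finset.prod_ne_zero_iff.mpr fun a ha => pow_ne_zero _ (hxa a ha)
  have hQx : Q.eval x = Q.leadingCoeff * PX := by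
    conv_lhs => rw [hQprod]
    rw [eval_mul, eval_C, eval_prod]
    congr 1
    exact Finset.prod_congr rfl fun a _ => by rw [eval_pow, eval_sub, eval_X, eval_C]
  have hPx : P.eval x = quo.eval x * PX +
      ∑ a ∈ s, ∑ j : Fin (n a), (r a j).coeff 0 * (x - a) ^ (j : ℕ) *
        ∏ k ∈ s.erase a, (x - k) ^ n k := by
    conv_lhs => rw [hP]
    rw [eval_add, eval_mul, eval_prod, eval_finsetSum]
    congr 1
    · congr 1
      exact Finset.prod_congr rfl fun a _ => by rw [eval_pow, eval_sub, eval_X, eval_C]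
    · refine Finset.sum_congr rfl fun a ha => ?_
      rw [eval_finsetSum]
      refine Finset.sum_congr rfl fun j _ => ?_
      have hev : eval x (r a j) = (r a j).coeff 0 := by
        conv_lhs => rw [hrC a ha j]
        rw [eval_C]
      rw [eval_mul, eval_mul, hev, eval_pow, eval_sub, eval_X, eval_C, eval_prod]
      congr 1
      exact Finset.prod_congr rfl fun k _ => by rw [eval_pow, eval_sub, eval_X, eval_C]
  -- divide by `PX`
  have hratio : ∀ a ∈ s, ∀ j : Fin (n a),
      (r a j).coeff 0 * (x - a) ^ (j : ℕ) * (∏ k ∈ s.erase a, (x - k) ^ n k) / PX =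
        (r a j).coeff 0 / (x - a) ^ (n a - j) := by
    intro a ha j
    have hsplit : PX = (x - a) ^ n a * ∏ k ∈ s.erase a, (x - k) ^ n k := by
      rw [hPX, ← Finset.mul_prod_erase s _ ha]
    have hE : (∏ k ∈ s.erase a, (x - k) ^ n k) ≠ 0 :=
      Finset.prod_ne_zero_iff.mpr fun k hk => pow_ne_zero _ (hxa k (Finset.mem_of_mem_erase hk))
    have hpow : (x - a) ^ n a = (x - a) ^ (j : ℕ) * (x - a) ^ (n a - j) := by
      rw [← pow_add, Nat.add_sub_cancel' j.2.le]
    rw [hsplit, hpow, mul_div_mul_right _ _ hE, mul_comm ((r a j).coeff 0) _,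
      mul_div_mul_left _ _ (pow_ne_zero _ (hxa a ha))]
  calc P.eval x / Q.eval x
      = (P.eval x / PX) / Q.leadingCoeff := by rw [hQx]; field_simp
    _ = (quo.eval x + ∑ a ∈ s, ∑ j ∈ Finset.range (n a),
          (if h : j < n a then (r a ⟨j, h⟩).coeff 0 else 0) / (x - a) ^ (n a - j)) /
          Q.leadingCoeff := by
        congr 1
        rw [hPx, add_div, mul_div_assoc, div_self hPX0, mul_one, Finset.sum_div]
        congr 1
        refine Finset.sum_congr rfl fun a ha => ?_
        rw [Finset.sum_div, ← Fin.sum_univ_eq_sum_range]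
        refine Fintype.sum_congr _ _ fun j => ?_
        rw [hratio a ha j, dif_pos j.2]

/-- **Evaluated partial fractions in a field extension.** For a ring hom `φ : K → F` (`K` algebraically
closed): `P^φ(x)/Q^φ(x) = (quo^φ(x) + Σ_{a ∈ roots Q} Σ_{j < mult a} φ(c_{a,j})/(x − φ a)^{mult a − j}) / φ(lc Q)`
at every `x : F` with `Q^φ(x) ≠ 0`; the data `quo, c` live in `K` (so they are algebraic when
`K = ℚ̄`). [folklore] -/
theorem exists_partialFraction_map_eval {K F : Type*} [Field K] [IsAlgClosed K] [DecidableEq K]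
    [Field F] (φ : K →+* F) (P Q : K[X]) (hQ : Q ≠ 0) :
    ∃ (quo : K[X]) (c : K → ℕ → K), ∀ x : F, (Q.map φ).eval x ≠ 0 →
      (P.map φ).eval x / (Q.map φ).eval x =
        ((quo.map φ).eval x + ∑ a ∈ Q.roots.toFinset, ∑ j ∈ Finset.range (Q.rootMultiplicity a),
          φ (c a j) / (x - φ a) ^ (Q.rootMultiplicity a - j)) / φ Q.leadingCoeff := by
  classical
  set s : Finset K := Q.roots.toFinset with hs
  set n : K → ℕ := fun a => Q.rootMultiplicity a with hn
  -- `Q = lc · Π_{a ∈ s} (X − a)^{n a}`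
  have hQprod : Q = C Q.leadingCoeff * ∏ a ∈ s, (X - C a) ^ n a := by
    rw [← prod_multiset_root_eq_finset_root,
      C_leadingCoeff_mul_prod_multiset_X_sub_C (IsAlgClosed.card_roots_eq_natDegree)]
  -- partial fractions with powers, denominators `X − a`
  have hmonic : ∀ a ∈ s, (X - C a : K[X]).Monic := fun a _ => monic_X_sub_C a
  have hcop : Set.Pairwise (s : Set K) fun a b => IsCoprime (X - C a : K[X]) (X - C b) :=
    fun a _ b _ hab => (pairwise_coprime_X_sub_C Function.injective_id) hab
  obtain ⟨quo, r, hdeg, hP⟩ := eq_quo_mul_prod_pow_add_sum_rem_mul_prod_pow P hmonic hcop n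
  -- the remainders are constants
  have hrC : ∀ a ∈ s, ∀ j : Fin (n a), r a j = C ((r a j).coeff 0) := by
    intro a ha j
    have h := hdeg a ha j
    rw [degree_X_sub_C] at h
    by_cases hr : r a j = 0
    · rw [hr]; simp
    · exact eq_C_of_natDegree_eq_zero (Nat.lt_one_iff.mp ((natDegree_lt_iff_degree_lt hr).mpr h))
  refine ⟨quo, fun a j => if h : j < n a then (r a ⟨j, h⟩).coeff 0 else 0, fun x hx => ?_⟩
  -- map to `F` and evaluate
  have hlc : φ Q.leadingCoeff ≠ 0 := (map_ne_zero φ).mpr (leadingCoeff_ne_zero.mpr hQ)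
  have hxa : ∀ a ∈ s, x - φ a ≠ 0 := by
    intro a ha h0
    have hxa' : x = φ a := sub_eq_zero.mp h0
    have hroot : IsRoot Q a := (mem_roots hQ).mp (Multiset.mem_toFinset.mp ha)
    apply hx
    rw [hxa', eval_map, eval₂_hom, hroot.eq_zero, map_zero]
  set PX : F := ∏ a ∈ s, (x - φ a) ^ n a with hPX
  have hPX0 : PX ≠ 0 := Finset.prod_ne_zero_iff.mpr fun a ha => pow_ne_zero _ (hxa a ha)
  have hfac : ∀ a, eval x ((X - C a : K[X]).map φ) = x - φ a := fun a => by
    rw [Polynomial.map_sub, map_X, map_C, eval_sub, eval_X, eval_C]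
  have hQx : (Q.map φ).eval x = φ Q.leadingCoeff * PX := by
    conv_lhs => rw [hQprod]
    rw [Polynomial.map_mul, map_C, Polynomial.map_prod, eval_mul, eval_C, eval_prod]
    congr 1
    exact Finset.prod_congr rfl fun a _ => by rw [Polynomial.map_pow, eval_pow, hfac]
  have hPx : (P.map φ).eval x = (quo.map φ).eval x * PX +
      ∑ a ∈ s, ∑ j : Fin (n a), φ ((r a j).coeff 0) * (x - φ a) ^ (j : ℕ) *
        ∏ k ∈ s.erase a, (x - φ k) ^ n k := by
    conv_lhs => rw [hP]
    rw [Polynomial.map_add, Polynomial.map_mul, Polynomial.map_prod, Polynomial.map_sum, eval_add,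
      eval_mul, eval_prod, eval_finsetSum]
    congr 1
    · congr 1
      exact Finset.prod_congr rfl fun a _ => by rw [Polynomial.map_pow, eval_pow, hfac]
    · refine Finset.sum_congr rfl fun a ha => ?_
      rw [Polynomial.map_sum, eval_finsetSum]
      refine Finset.sum_congr rfl fun j _ => ?_
      have hev : eval x ((r a j).map φ) = φ ((r a j).coeff 0) := by
        conv_lhs => rw [hrC a ha j]
        rw [map_C, eval_C]
      rw [Polynomial.map_mul, Polynomial.map_mul, Polynomial.map_pow, Polynomial.map_prod, eval_mul,
        eval_mul, hev, eval_pow, hfac, eval_prod]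
      congr 1
      exact Finset.prod_congr rfl fun k _ => by rw [Polynomial.map_pow, eval_pow, hfac]
  -- divide by `PX`
  have hratio : ∀ a ∈ s, ∀ j : Fin (n a),
      φ ((r a j).coeff 0) * (x - φ a) ^ (j : ℕ) * (∏ k ∈ s.erase a, (x - φ k) ^ n k) / PX =
        φ ((r a j).coeff 0) / (x - φ a) ^ (n a - j) := by
    intro a ha j
    have hsplit : PX = (x - φ a) ^ n a * ∏ k ∈ s.erase a, (x - φ k) ^ n k := by
      rw [hPX, ← Finset.mul_prod_erase s _ ha]
    have hE : (∏ k ∈ s.erase a, (x - φ k) ^ n k) ≠ 0 :=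
      Finset.prod_ne_zero_iff.mpr fun k hk => pow_ne_zero _ (hxa k (Finset.mem_of_mem_erase hk))
    have hpow : (x - φ a) ^ n a = (x - φ a) ^ (j : ℕ) * (x - φ a) ^ (n a - j) := by
      rw [← pow_add, Nat.add_sub_cancel' j.2.le]
    rw [hsplit, hpow, mul_div_mul_right _ _ hE, mul_comm (φ ((r a j).coeff 0)) _,
      mul_div_mul_left _ _ (pow_ne_zero _ (hxa a ha))]
  calc (P.map φ).eval x / (Q.map φ).eval x
      = ((P.map φ).eval x / PX) / φ Q.leadingCoeff := by rw [hQx]; field_simp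
    _ = ((quo.map φ).eval x + ∑ a ∈ s, ∑ j ∈ Finset.range (n a),
          φ (if h : j < n a then (r a ⟨j, h⟩).coeff 0 else 0) / (x - φ a) ^ (n a - j)) /
          φ Q.leadingCoeff := by
        congr 1
        rw [hPx, add_div, mul_div_assoc, div_self hPX0, mul_one, Finset.sum_div]
        congr 1
        refine Finset.sum_congr rfl fun a ha => ?_
        rw [Finset.sum_div, ← Fin.sum_univ_eq_sum_range]
        refine Fintype.sum_congr _ _ fun j => ?_
        rw [hratio a ha j, dif_pos j.2]

end KZ.BakerSectorComplex

end Literature.NumberTheory.Transcendental
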